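import Mathlib
import Literature.MathematicalPhysics.QuantumFieldTheory.CentralFunctionTransferKernel
import Literature.MathematicalPhysics.QuantumFieldTheory.ContinuumLimitsYM2TelescopeProofs
import HarnessLib

/-!
# The slice transfer kernel of two-dimensional lattice gauge theory: gauge fixing to the class-averaged kernel

Lattice half of the exact solution of two-dimensional lattice gauge theory in transfer-matrix form (Migdal 1975;
Driver 1989, §7; the `M = 0` member of the free tube of the route `ContractibleFibre` of `QuantumFields/YangMills`).
For a compact group `G`, a continuous central weight `ω` and the class-averaged kernels
`k_m(A, B) = ∫ ω^{⋆(m+1)}(A⁻¹ x B x⁻¹) dx` of `CentralFunctionTransferKernel.lean` (variables with defining equations):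

* `measurePreserving_restrict_coords`, `measurePreserving_ofFn_prod`, `measurePreserving_holonomy` — restricting a
  product Haar configuration to finitely many distinct links and multiplying them in order pushes product Haar
  measure forward to Haar measure (the law of the holonomy of a simple lattice path is Haar);
* `integral_prod_plaquette_eq_ladder` (**gauge fixing**) — the one-row transfer integral of `n + 1` plaquettes in a
  periodic row, `∫ ∏ᵢ ω(eᵢ bᵢ e_{i+1}⁻¹ aᵢ⁻¹) de` (temporal links `e`, lower / upper spatial links `a`, `b`), depends on
  `a`, `b` only through the holonomies `hol a = a₀ ⋯ a_n`, `hol b` (substitution `eᵢ ↦ (a₀⋯a_{i−1})⁻¹ eᵢ (b₀⋯b_{i−1})`);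
* `ladder_eq_kernel` — integrating the open ladder by telescoping (`PlanarYM2.teleDiff`, Driver's splicing formula
  `integral_pi_ofFn_prod_mul_prod`) gives `k_n(hol a, hol b)`: **the slice transfer kernel of `YM₂` on a circle of
  `n + 1` links is the `(n+1)`-st composition power of the one-plaquette class kernel, evaluated at the holonomies**
  (`integral_prod_plaquette_eq_kernel`);
* `integral_pi_prodUnique` — bookkeeping for a singleton transverse factor in the slice index.

References: A. A. Migdal, Sov. Phys. JETP 42 (1975) 413; B. K. Driver, Commun. Math. Phys. 123 (1989) 575, §7;
E. Seiler, LNP 159 (1982) Ch. 2.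
-/

set_option autoImplicit false

noncomputable section

open scoped BigOperators
open MeasureTheory Filter Function
open Literature.MathematicalPhysics.QuantumLattice Literature.MathematicalPhysics.QuantumFieldTheory
  Literature.MathematicalPhysics.QuantumFieldTheory.CentralKernel Literature.Analysis.OperatorTheory

namespace Literature.MathematicalPhysics.QuantumFieldTheory.PlanarGauge

/-! ### Bookkeeping: restriction of coordinates, singleton factors -/

section Restrict

variable {Y : Type*} [MeasurableSpace Y] (μ : Measure Y) [IsProbabilityMeasure μ]

/-- **Restricting a product probability measure to finitely many distinct coordinates is measure preserving**
(`piEquivPiSubtypeProd` onto the range, then relabelling by `Equiv.ofInjective`). [folklore] -/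
theorem measurePreserving_restrict_coords {E : Type*} [Fintype E] {m : ℕ} (c : Fin m → E) (hc : Injective c) :
    MeasurePreserving (fun (x : E → Y) (i : Fin m) => x (c i)) (Measure.pi fun _ : E => μ)
      (Measure.pi fun _ : Fin m => μ) := by
  classical
  set p : E → Prop := fun e => e ∈ Set.range c with hp
  letI : Fintype (Subtype p) := Subtype.fintype p
  have h1 := measurePreserving_fst.comp (measurePreserving_piEquivPiSubtypeProd (fun _ : E => μ) p)
  set f : Subtype p ≃ Fin m := (Equiv.ofInjective c hc).symm with hf
  have h := (measurePreserving_piCongrLeft (fun _ : Fin m => μ) f).comp h1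
  have hE : ∀ (x : E → Y) (j : Subtype p), (MeasurableEquiv.piEquivPiSubtypeProd (fun _ : E => Y) p x).1 j = x j :=
    fun x j => rfl
  have he : (⇑(MeasurableEquiv.piCongrLeft (fun _ : Fin m => Y) f) ∘
      (Prod.fst ∘ ⇑(MeasurableEquiv.piEquivPiSubtypeProd (fun _ : E => Y) p))) = fun (x : E → Y) (i : Fin m) => x (c i) := by
    funext x i
    simp only [comp_apply, MeasurableEquiv.coe_piCongrLeft, Equiv.piCongrLeft_apply_eq_cast, cast_eq, hE, hf,
      Equiv.symm_symm]
    rfl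
  rw [he] at h
  exact h

/-- **A singleton transverse factor in the index can be dropped**: for `Unique β`,
`∫ F(e) dμ^{⊗(α × β)}(e) = ∫ F(s ↦ e'(s.1)) dμ^{⊗α}(e')`. [folklore] -/
theorem integral_pi_prodUnique {α β : Type*} [Fintype α] [Fintype β] [Unique β] (F : (α × β → Y) → ℝ) :
    ∫ e, F e ∂(Measure.pi fun _ : α × β => μ) = ∫ e', F (fun s => e' s.1) ∂(Measure.pi fun _ : α => μ) := by
  set σ : α ≃ α × β := (Equiv.prodUnique α β).symm with hσ
  have h := measurePreserving_piCongrLeft (fun _ : α × β => μ) σ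
  rw [← h.integral_comp']
  refine integral_congr_ae (Eventually.of_forall fun e' => ?_)
  dsimp only
  congr 1
  funext s
  simp only [MeasurableEquiv.coe_piCongrLeft, Equiv.piCongrLeft_apply_eq_cast, cast_eq, hσ, Equiv.symm_symm,
    Equiv.prodUnique_apply]

end Restrict

/-! ### The holonomy of independent Haar links is Haar distributed -/

section Holonomy

variable {G : Type*} [Group G] [TopologicalSpace G] [IsTopologicalGroup G] [CompactSpace G] [MeasurableSpace G]
  [BorelSpace G] [SecondCountableTopology G]

omit [SecondCountableTopology G] in
/-- `(haarConv 1)^[m] 1 = 1`. [folklore] -/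
theorem haarConv_one_iterate : ∀ m : ℕ, ((haarConv (fun _ : G => (1 : ℝ)))^[m] fun _ => (1 : ℝ)) = fun _ => 1
  | 0 => rfl
  | m + 1 => by
    rw [Function.iterate_succ_apply', haarConv_one_iterate m]
    funext x
    simp [haarConv_apply]

/-- **The ordered product of `m + 1` independent Haar-distributed group elements is Haar distributed**: the map
`w ↦ w₀ w₁ ⋯ w_m` pushes `∏ dwᵢ` forward to Haar measure (Driver's splicing formula `integral_pi_ofFn_prod_mul_prod` with
the trivial weight, applied to indicators). [cite: DriverCMP1989, Thm 7.4 (proof)] -/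
theorem measurePreserving_ofFn_prod (m : ℕ) :
    MeasurePreserving (fun w : Fin (m + 1) → G => (List.ofFn w).prod) (Measure.pi fun _ => haarProbability G)
      (haarProbability G) := by
  classical
  refine ⟨measurable_ofFn_prod (m + 1), Measure.ext fun s hs => ?_⟩
  rw [Measure.map_apply (measurable_ofFn_prod (m + 1)) hs]
  have h := integral_pi_ofFn_prod_mul_prod (G := G) (φ := fun _ => (1 : ℝ)) continuous_const m
    (F := s.indicator 1) (measurable_one.indicator hs) ⟨1, fun g => by
      rw [Set.indicator_apply]; split_ifs <;> simp⟩
  simp only [haarConv_one_iterate, Finset.prod_const_one, mul_one] at h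
  have h1 : ∫ w : Fin (m + 1) → G, s.indicator 1 (List.ofFn w).prod ∂(Measure.pi fun _ => haarProbability G) =
      (Measure.pi fun _ : Fin (m + 1) => haarProbability G).real ((fun w : Fin (m + 1) → G => (List.ofFn w).prod) ⁻¹' s) := by
    rw [← integral_indicator_one ((measurable_ofFn_prod (m + 1)) hs)]
    rfl
  have h2 : ∫ g, s.indicator 1 g ∂haarProbability G = (haarProbability G).real s := integral_indicator_one hs
  rw [h1, h2] at h
  exact (ENNReal.toReal_eq_toReal_iff' (measure_ne_top _ _) (measure_ne_top _ _)).1 h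

/-- **The holonomy of a simple path of `m + 1` distinct links is Haar distributed** under product Haar measure:
`x ↦ x(c 0) x(c 1) ⋯ x(c m)` is measure preserving for an injective labelling `c`. [folklore] -/
theorem measurePreserving_holonomy {E : Type*} [Fintype E] {m : ℕ} (c : Fin (m + 1) → E) (hc : Injective c) :
    MeasurePreserving (fun x : E → G => (List.ofFn fun i => x (c i)).prod) (Measure.pi fun _ : E => haarProbability G)
      (haarProbability G) :=
  (measurePreserving_ofFn_prod m).comp (measurePreserving_restrict_coords (haarProbability G) c hc)

/-- `Fin.partialProd f (Fin.last n)` is the full ordered product. [folklore] -/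
theorem partialProd_last {M : Type*} [Monoid M] {n : ℕ} (f : Fin n → M) :
    Fin.partialProd f (Fin.last n) = (List.ofFn f).prod := by
  simp [Fin.partialProd, List.take_of_length_le, List.length_ofFn]

end Holonomy

/-! ### Gauge fixing of the one-row transfer integral -/

section GaugeFix

variable {G : Type*} [Group G] (ω : G → ℝ)

/-- **The gauge-fixed integrand.**  After the substitution `eᵢ = (a₀⋯a_{i−1})⁻¹ vᵢ (b₀⋯b_{i−1})` the plaquette
variables of a periodic row of `n + 1` plaquettes become `vᵢ v_{i+1}⁻¹` (`i < n`) and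
`v_n (hol b) v₀⁻¹ (hol a)⁻¹`, up to conjugation (killed by a central weight). [cite: DriverCMP1989, Thm 7.4 (proof)] -/
theorem prod_plaquette_gaugeFix (hω : ∀ g h, ω (h * g * h⁻¹) = ω g) {n : ℕ} (a b v : Fin (n + 1) → G) :
    ∏ i : Fin (n + 1), ω ((Fin.partialProd a i.castSucc)⁻¹ * v i * Fin.partialProd b i.castSucc * b i *
        ((Fin.partialProd a (i + 1).castSucc)⁻¹ * v (i + 1) * Fin.partialProd b (i + 1).castSucc)⁻¹ * (a i)⁻¹) =
      (∏ j : Fin n, ω (v j.castSucc * (v j.succ)⁻¹)) *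
        ω (v (Fin.last n) * Fin.partialProd b (Fin.last (n + 1)) * (v 0)⁻¹ * (Fin.partialProd a (Fin.last (n + 1)))⁻¹) := by
  rw [Fin.prod_univ_castSucc]
  congr 1
  · refine Finset.prod_congr rfl fun j _ => ?_
    rw [Fin.coeSucc_eq_succ, ← Fin.succ_castSucc, Fin.partialProd_succ, Fin.partialProd_succ]
    conv_rhs => rw [← hω _ (Fin.partialProd a j.castSucc.castSucc)⁻¹]
    exact congrArg ω (by group)
  · rw [Fin.last_add_one n, ← Fin.succ_last, Fin.partialProd_succ, Fin.partialProd_succ, Fin.castSucc_zero,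
      Fin.partialProd_zero, Fin.partialProd_zero]
    conv_rhs => rw [← hω _ (Fin.partialProd a (Fin.last n).castSucc)⁻¹]
    exact congrArg ω (by group)

variable [TopologicalSpace G] [IsTopologicalGroup G] [CompactSpace G] [MeasurableSpace G] [BorelSpace G]
  [SecondCountableTopology G]

/-- **Gauge fixing of the one-row transfer integral.**  For a continuous central weight, the transfer integral of
a periodic row of `n + 1` plaquettes depends on the spatial links only through their holonomies:
`∫ ∏ᵢ ω(eᵢ bᵢ e_{i+1}⁻¹ aᵢ⁻¹) de = ∫ [∏_{j<n} ω(vⱼ v_{j+1}⁻¹)] ω(v_n (hol b) v₀⁻¹ (hol a)⁻¹) dv` (the substitution is a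
product of two-sided translations, measure preserving for product Haar measure). [cite: DriverCMP1989, Thm 7.4 (proof)] -/
theorem integral_prod_plaquette_eq_ladder (hωc : Continuous ω) (hω : ∀ g h, ω (h * g * h⁻¹) = ω g) {n : ℕ}
    (a b : Fin (n + 1) → G) :
    ∫ e : Fin (n + 1) → G, ∏ i, ω (e i * b i * (e (i + 1))⁻¹ * (a i)⁻¹) ∂(Measure.pi fun _ => haarProbability G) =
      ∫ v : Fin (n + 1) → G, (∏ j : Fin n, ω (v j.castSucc * (v j.succ)⁻¹)) *
        ω (v (Fin.last n) * (List.ofFn b).prod * (v 0)⁻¹ * ((List.ofFn a).prod)⁻¹)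
        ∂(Measure.pi fun _ => haarProbability G) := by
  set Ψ : (Fin (n + 1) → G) → Fin (n + 1) → G :=
    fun v i => (Fin.partialProd a i.castSucc)⁻¹ * v i * Fin.partialProd b i.castSucc with hΨ
  have hΨm : MeasurePreserving Ψ (Measure.pi fun _ => haarProbability G) (Measure.pi fun _ => haarProbability G) :=
    measurePreserving_pi (fun _ : Fin (n + 1) => haarProbability G) (fun _ : Fin (n + 1) => haarProbability G)
      fun i => WilsonGauge.measurePreserving_mul_mul (Fin.partialProd a i.castSucc)⁻¹ (Fin.partialProd b i.castSucc)
  have hF : Measurable fun e : Fin (n + 1) → G => ∏ i, ω (e i * b i * (e (i + 1))⁻¹ * (a i)⁻¹) := by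
    refine Finset.measurable_prod _ fun i _ => hωc.measurable.comp ?_
    exact ((((measurable_pi_apply i).mul_const _).mul (measurable_pi_apply (i + 1)).inv).mul_const _)
  have h := integral_map (μ := Measure.pi fun _ : Fin (n + 1) => haarProbability G) hΨm.measurable.aemeasurable
    (f := fun e : Fin (n + 1) → G => ∏ i, ω (e i * b i * (e (i + 1))⁻¹ * (a i)⁻¹)) hF.aestronglyMeasurable
  rw [hΨm.map_eq] at h
  refine h.trans ?_
  rw [← partialProd_last a, ← partialProd_last b]
  refine integral_congr_ae (Eventually.of_forall fun v => ?_)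
  exact prod_plaquette_gaugeFix ω hω a b v

/-- **The open ladder integrates to a convolution power.**  For fixed end link `x = v₀`, telescoping the remaining
links (`PlanarYM2.teleDiff x`, measure preserving) turns the ladder integrand into `(∏ⱼ ω(uⱼ)) ω((∏u)⁻¹ x B x⁻¹ A⁻¹)`,
and Driver's splicing formula `integral_pi_ofFn_prod_mul_prod` evaluates the `u`-integral to
`(ω^{⋆n} ⋆ ω)(x B x⁻¹ A⁻¹) = ω^{⋆(n+1)}(A⁻¹ x B x⁻¹)` (central weights commute under convolution).
[cite: DriverCMP1989, Thm 7.4 (proof) and Def 7.1] -/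
theorem integral_ladder_cons_eq (hωc : Continuous ω) (hω : ∀ g h, ω (h * g * h⁻¹) = ω g) {n : ℕ} (A B x : G) :
    ∫ h : Fin n → G, (∏ j : Fin n, ω ((Fin.cons x h : Fin (n + 1) → G) j.castSucc * (h j)⁻¹)) *
        ω ((Fin.cons x h : Fin (n + 1) → G) (Fin.last n) * B * x⁻¹ * A⁻¹) ∂(Measure.pi fun _ => haarProbability G) =
      ((haarConv ω)^[n] ω) (A⁻¹ * x * B * x⁻¹) := by
  set Z : G := x * B * x⁻¹ * A⁻¹ with hZ
  have hAZ : A⁻¹ * x * B * x⁻¹ = A⁻¹ * Z * A⁻¹⁻¹ := by rw [hZ]; group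
  -- the telescoped integrand
  set Φ : (Fin n → G) → ℝ := fun u => (∏ j, ω (u j)) * ω (((List.ofFn u).prod)⁻¹ * Z) with hΦ
  have hΦm : Measurable Φ :=
    (Finset.measurable_prod _ fun j _ => hωc.measurable.comp (measurable_pi_apply j)).mul
      (hωc.measurable.comp ((measurable_ofFn_prod n).inv.mul_const _))
  have hlast : ∀ h : Fin n → G, (Fin.cons x h : Fin (n + 1) → G) (Fin.last n) =
      ((List.ofFn (PlanarYM2.teleDiff x h)).prod)⁻¹ * x := by
    intro h
    have hp := PlanarYM2.prod_ofFn_teleDiff x h n le_rfl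
    simp only [Fin.castLE_rfl, id_eq] at hp
    have hp' : (List.ofFn (PlanarYM2.teleDiff x h)).prod = x * ((Fin.cons x h : Fin (n + 1) → G) (Fin.last n))⁻¹ := hp
    rw [hp', mul_inv_rev, inv_inv, inv_mul_cancel_right]
  have hpt : ∀ h : Fin n → G, (∏ j : Fin n, ω ((Fin.cons x h : Fin (n + 1) → G) j.castSucc * (h j)⁻¹)) *
      ω ((Fin.cons x h : Fin (n + 1) → G) (Fin.last n) * B * x⁻¹ * A⁻¹) = Φ (PlanarYM2.teleDiff x h) := by
    intro h
    simp only [hΦ, hlast h, PlanarYM2.teleDiff, hZ, mul_assoc]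
  simp_rw [hpt]
  rw [PlanarYM2.integral_comp_teleDiff x hΦm.aestronglyMeasurable]
  -- the `u`-integral: splicing formula
  cases n with
  | zero =>
    simp only [hΦ, List.ofFn_zero, List.prod_nil, inv_one, one_mul, Finset.univ_eq_empty, Finset.prod_empty,
      integral_const, smul_eq_mul, probReal_univ, Function.iterate_zero, id_eq]
    rw [hAZ, hω]
  | succ m =>
    obtain ⟨C, -, hC⟩ := exists_forall_abs_le_of_continuous hωc
    have h1 := integral_pi_ofFn_prod_mul_prod (G := G) hωc m (F := fun g => ω (g⁻¹ * Z))
      (hωc.measurable.comp (measurable_inv.mul_const _)) ⟨C, fun g => (Real.norm_eq_abs _).trans_le (hC _)⟩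
    have h2 : ∫ u : Fin (m + 1) → G, Φ u ∂(Measure.pi fun _ => haarProbability G) =
        ∫ w : Fin (m + 1) → G, (fun g => ω (g⁻¹ * Z)) (List.ofFn w).prod * ∏ i, ω (w i)
          ∂(Measure.pi fun _ => haarProbability G) :=
      integral_congr_ae (Eventually.of_forall fun u => mul_comm _ _)
    rw [h2, h1, hAZ, central_haarConv_iterate hω (m + 1) Z A⁻¹, Function.iterate_succ_apply',
      haarConv_comm_of_central hω, haarConv_apply]
    exact integral_congr_ae (Eventually.of_forall fun g => mul_comm _ _)

variable (k : ℕ → G → G → ℝ)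
  (hk : ∀ m A B, k m A B = ∫ x, ((haarConv ω)^[m] ω) (A⁻¹ * x * B * x⁻¹) ∂haarProbability G)

include hk in
/-- **The one-row transfer integral is the class-averaged kernel at the holonomies**:
`∫ ∏ᵢ ω(eᵢ bᵢ e_{i+1}⁻¹ aᵢ⁻¹) de = k_n(a₀⋯a_n, b₀⋯b_n)` — the transfer kernel of two-dimensional lattice gauge theory
on a circle of `n + 1` links is the `(n+1)`-st composition power of the one-plaquette class kernel (Migdal's exact
solution in transfer-matrix form). [cite: DriverCMP1989, Thm 7.4 (proof) and Def 7.1] -/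
theorem integral_prod_plaquette_eq_kernel (hωc : Continuous ω) (hω : ∀ g h, ω (h * g * h⁻¹) = ω g) {n : ℕ}
    (a b : Fin (n + 1) → G) :
    ∫ e : Fin (n + 1) → G, ∏ i, ω (e i * b i * (e (i + 1))⁻¹ * (a i)⁻¹) ∂(Measure.pi fun _ => haarProbability G) =
      k n (List.ofFn a).prod (List.ofFn b).prod := by
  set μ := haarProbability G with hμ
  set A : G := (List.ofFn a).prod with hA
  set B : G := (List.ofFn b).prod with hB
  rw [integral_prod_plaquette_eq_ladder ω hωc hω a b, ← hA, ← hB]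
  -- split off the end link `x = v 0`
  set I : (Fin (n + 1) → G) → ℝ := fun v => (∏ j : Fin n, ω (v j.castSucc * (v j.succ)⁻¹)) *
    ω (v (Fin.last n) * B * (v 0)⁻¹ * A⁻¹) with hI
  have hIc : Continuous I := by
    refine (continuous_finsetProd _ fun j _ => hωc.comp ?_).mul (hωc.comp ?_)
    · exact (continuous_apply j.castSucc).mul (continuous_apply j.succ).inv
    · exact (((continuous_apply (Fin.last n)).mul continuous_const).mul (continuous_apply 0).inv).mul
        continuous_const
  set e := MeasurableEquiv.piFinSuccAbove (fun _ : Fin (n + 1) => G) 0 with he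
  have hme : MeasurePreserving e (Measure.pi fun _ : Fin (n + 1) => μ) (μ.prod (Measure.pi fun _ : Fin n => μ)) :=
    measurePreserving_piFinSuccAbove (fun _ : Fin (n + 1) => μ) 0
  have hsymm : ∀ z : G × (Fin n → G), e.symm z = Fin.cons z.1 z.2 := fun z => by
    simp only [he, MeasurableEquiv.piFinSuccAbove_symm_apply, Fin.insertNthEquiv, Equiv.coe_fn_mk,
      Fin.insertNth_zero']
  have hint : Integrable (fun z : G × (Fin n → G) => I (e.symm z)) (μ.prod (Measure.pi fun _ : Fin n => μ)) := by
    rw [show (fun z : G × (Fin n → G) => I (e.symm z)) = I ∘ e.symm from rfl,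
      hme.symm.integrable_comp_emb e.symm.measurableEmbedding]
    exact hIc.integrable_of_hasCompactSupport (HasCompactSupport.of_compactSpace I)
  show ∫ v, I v ∂(Measure.pi fun _ : Fin (n + 1) => μ) = k n A B
  rw [← hme.symm.integral_comp', integral_prod _ hint, hk]
  refine integral_congr_ae (Eventually.of_forall fun x => ?_)
  dsimp only
  simp_rw [hsymm]
  simp only [hI, Fin.cons_succ, Fin.cons_zero]
  exact integral_ladder_cons_eq ω hωc hω A B x

end GaugeFix

/-! ### The Wilson weight `ω = exp(β Re tr ρ)` -/

section Wilson

variable {G : Type*} [Group G] {N : ℕ} (ρ : G →* Matrix (Fin N) (Fin N) ℂ) (β : ℝ)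

/-- The Wilson weight `exp(β Re tr ρ)` is central. [folklore] -/
theorem wilsonWeight_central (g h : G) :
    Real.exp (β * (ρ (h * g * h⁻¹)).trace.re) = Real.exp (β * (ρ g).trace.re) := by
  rw [show h * g * h⁻¹ = h⁻¹⁻¹ * g * h⁻¹ by rw [inv_inv], Literature.Barriers.QuantumFields.FiniteTemperature.trace_re_rep_conj]

/-- The Wilson weight is symmetric under inversion for unitary `ρ`. [folklore] -/
theorem wilsonWeight_symm (hρu : ∀ g, ρ g ∈ Matrix.unitaryGroup (Fin N) ℂ) (g : G) :
    Real.exp (β * (ρ g⁻¹).trace.re) = Real.exp (β * (ρ g).trace.re) := by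
  rw [Literature.Barriers.QuantumFields.FiniteTemperature.trace_re_rep_inv ρ hρu]

/-- The Wilson weight is continuous for continuous `ρ`. [folklore] -/
theorem continuous_wilsonWeight [TopologicalSpace G] (hρ : Continuous ρ) :
    Continuous fun g : G => Real.exp (β * (ρ g).trace.re) :=
  Real.continuous_exp.comp (continuous_const.mul (Complex.continuous_re.comp (Continuous.matrix_trace hρ)))

variable [TopologicalSpace G] [IsTopologicalGroup G] [CompactSpace G] [MeasurableSpace G] [BorelSpace G]
  [SecondCountableTopology G]

omit [SecondCountableTopology G] in
/-- **The kernel `(x, y) ↦ exp(β Re tr ρ(x y⁻¹))` is of positive type** for `β ≥ 0` and unitary `ρ`: in real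
coordinates `Re tr ρ(x y⁻¹) = Σ (Re·Re + Im·Im)` of the matrix entries (`trace_re_rep_mul_inv_eq_sum`), so
`integral_mul_exp_sum_mul_mul_nonneg` applies. [cite: Luscher1977] -/
theorem posType_wilsonWeight (hρ : Continuous ρ) (hρu : ∀ g, ρ g ∈ Matrix.unitaryGroup (Fin N) ℂ) (hβ : 0 ≤ β)
    (φ : G → ℝ) (hφ : Measurable φ) (hφ1 : ∀ x, |φ x| ≤ 1) :
    0 ≤ ∫ z, φ z.1 * Real.exp (β * (ρ (z.1 * z.2⁻¹)).trace.re) * φ z.2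
      ∂((haarProbability G).prod (haarProbability G)) := by
  obtain ⟨p, ⟨e⟩⟩ := Finite.exists_equiv_fin ((Fin N × Fin N) ⊕ (Fin N × Fin N))
  obtain ⟨w, hw⟩ : ∃ w : (Fin N × Fin N) ⊕ (Fin N × Fin N) → G → ℝ,
      w = Sum.elim (fun t x => (ρ x t.1 t.2).re) (fun t x => (ρ x t.1 t.2).im) := ⟨_, rfl⟩
  have hwm : ∀ j, Measurable (w j) := by
    rw [hw]; rintro (t | t)
    · exact (Complex.continuous_re.comp (hρ.matrix_elem t.1 t.2)).measurable
    · exact (Complex.continuous_im.comp (hρ.matrix_elem t.1 t.2)).measurable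
  have hw1 : ∀ j x, |w j x| ≤ 1 := by
    rw [hw]; rintro (t | t) x
    · exact (Complex.abs_re_le_norm _).trans (entry_norm_bound_of_unitary (hρu _) _ _)
    · exact (Complex.abs_im_le_norm _).trans (entry_norm_bound_of_unitary (hρu _) _ _)
  have hS : ∀ x y : G, (ρ (x * y⁻¹)).trace.re = ∑ j, w (e.symm j) x * w (e.symm j) y := by
    intro x y
    rw [Equiv.sum_comp e.symm (fun j => w j x * w j y), Fintype.sum_sum_type, trace_re_rep_mul_inv_eq_sum ρ hρu,
      ← Finset.sum_add_distrib, Fintype.sum_prod_type]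
    simp only [hw, Sum.elim_inl, Sum.elim_inr]
    refine Finset.sum_congr rfl fun k _ => Finset.sum_congr rfl fun l _ => ?_
    ring
  simp_rw [hS]
  exact integral_mul_exp_sum_mul_mul_nonneg _ (fun x j => w (e.symm j) x) (fun j => hwm _) 1 (fun x j => hw1 _ _)
    β hβ φ hφ 1 hφ1

variable (ω : G → ℝ) (hωρ : ∀ g, ω g = Real.exp (β * (ρ g).trace.re)) (k : ℕ → G → G → ℝ)
  (hk : ∀ m A B, k m A B = ∫ x, ((haarConv ω)^[m] ω) (A⁻¹ * x * B * x⁻¹) ∂haarProbability G)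

include hωρ hk in
/-- **The planar layer integral of the free tube at `M = 0`** (spatial slice `Fin (n+1) × Fin 1 × Fin 1`, only the
`(time, 1)` plaquettes weighted): integrating the `n + 1` temporal links of one layer gives
`k_n(hol a, hol b)` with the direction-`1` holonomies `hol a = a₀ a₁ ⋯ a_n` of the two slices. [cite: DriverCMP1989, Thm 7.4 (proof) and Def 7.1] -/
theorem integral_exp_planarLayer_eq_kernel (hρ : Continuous ρ) {n : ℕ}
    (a b : (Fin (n + 1) × Fin 1 × Fin 1) × Fin 3 → G) :
    ∫ e : Fin (n + 1) × Fin 1 × Fin 1 → G, Real.exp (β * ∑ s,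
        (ρ (e s * b (s, 0) * (e (s.1 + 1, s.2.1, s.2.2))⁻¹ * (a (s, 0))⁻¹)).trace.re)
        ∂(Measure.pi fun _ => haarProbability G) =
      k n (List.ofFn fun i : Fin (n + 1) => a ((i, 0, 0), 0)).prod
        (List.ofFn fun i : Fin (n + 1) => b ((i, 0, 0), 0)).prod := by
  have hωc : Continuous ω := by
    rw [show ω = fun g => Real.exp (β * (ρ g).trace.re) from funext hωρ]; exact continuous_wilsonWeight ρ β hρ
  have hω : ∀ g h, ω (h * g * h⁻¹) = ω g := fun g h => by rw [hωρ, hωρ, wilsonWeight_central]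
  letI : Unique (Fin 1 × Fin 1) := Unique.mk' _
  rw [integral_pi_prodUnique]
  simp only [Fintype.sum_prod_type, Fin.sum_univ_one, Finset.mul_sum, Real.exp_sum, ← hωρ]
  exact integral_prod_plaquette_eq_kernel ω k hk hωc hω (fun i => a ((i, 0, 0), 0)) fun i => b ((i, 0, 0), 0)

end Wilson

end Literature.MathematicalPhysics.QuantumFieldTheory.PlanarGauge

end
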